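import Summits.QuantumFields.YangMills.Theorems.PoincareLipschitzMesoscopicConcentrationOfEntropy
import Summits.QuantumFields.YangMills.Theorems.PoincareLipschitzMesoscopicConcentrationLOfModerateDeviation
import Literature.Probability.Moments.HerbstArgumentRestricted
import HarnessLib

/-!
# LINE 30 «CurvaturePoincare», residual stub `stub_moderateDeviationResidual` (MD) of K1′
# `PoincareLipschitz.MesoscopicConcentrationL` (stmt-QuantumFields-23532) ⟸ a RESTRICTED-RANGE entropy bound

Cell `ym3-torus` (YM ladder rung R3 = continuum SU(2) Yang–Mills on T³ — a RUNG, NOT d = 4, NOT infinite volume, NOT a mass gap,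
NOT Clay).  Hand `leafhand-qf-poincarelipschitz-1` g0; `--supports stmt-QuantumFields-23532`; theorems only, definition-free.

THE POINT (a sharper door than ✓`PoincareLipschitzMesoscopicConcentrationOfEntropy.mesoscopicConcentrationL_of_entropyBound`).
The registered residual MD of LINE 30 (`Cruxes/HistoryTailL/Lines/curvature_poincare.lean`, skeleton e95b7bfb) is the crux
restricted to MESOSCOPIC boxes `17·L³ < n ≤ β_K` and to the MODERATE-DEVIATION WINDOW `β_K r² ≤ C_th·Λ²·n⁵`; the large-deviation
regime is a tree theorem (✓`…OfModerateDeviation.largeDeviation`, curvature pinning + local exponential moment).  Herbst's argument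
run only on the window of tilts it actually needs shows that MD follows from the entropy inequality

  `Ent_{μ_K}(e^{lf}) ≤ cE·(n²Λ²/β_K)·l²·∫e^{lf} dμ_K`   for SMALL TILTS ONLY:  `0 < l`, `(lΛ)² ≤ l₁²·β_K·n`,

i.e. for tilted laws `e^{lf}μ_K/Z` whose tilt has link-Lipschitz constant `lΛ ≤ l₁√(β_K n)` — any `l₁ > 0`, any `cE > 0` (constants of MD:
`Cc = 1`, `cc = min(1/(4cE), l₁/(2(C_th+1)))`).  Inside the window the optimal Chernoff tilt `l = β_K r/(2cE n²Λ²)` is admissible and gives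
the Gaussian rate `exp(−β_K r²/(4cE n²Λ²))`; where it is not, the maximal admissible tilt gives `exp(−l₁√(β_K n)·r/(2Λ))`, which dominates
`exp(−cc·β_K r²/(n²Λ²))` throughout `β_K r² ≤ C_th Λ² n⁵`.  The unrestricted entropy bound (all real `l`, = a log-Sobolev inequality on the
class) is NOT needed for MD: large tilts are the large-deviation regime, already closed by other means.

RESULTS (namespace `Summit.QuantumFields.YangMills.Theorems.CurvaturePoincareModerateDeviationOfRestrictedEntropy`):
* `moderateDeviationResidual_of_restrictedEntropy (hEntR) : ⟨registered text of stub_moderateDeviationResidual⟩`;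
* `mesoscopicConcentrationL_of_restrictedEntropy (hEntR) : …Theses.PoincareLipschitz.MesoscopicConcentrationL` (composition with
  ✓`mesoscopicConcentrationL_of_moderateDeviation`).

HONEST SCOPE.  A DOOR: `hEntR` (the small-tilt entropy bound at the Hodge–Poincaré scale on mesoscopic boxes, uniform in the torus and in
`n ≤ β_K`) is OPEN and is the organ K1 in its weakest consumed form; nothing of MD, K1′, `HistoryTailL`, any rung or summit is proved here.
Probabilistic input: ✓`Literature.Probability.Moments.herbst_windowed_tail_bound` (restricted-range Herbst, kernel-proved).
[cite: BakryGentilLedoux2014, Prop. 5.4.1; Balaban1985UV3, (3) p.256]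
-/

set_option autoImplicit false

noncomputable section

open scoped BigOperators
open MeasureTheory
open Literature.MathematicalPhysics.QuantumFieldTheory
open Literature.MathematicalPhysics.QuantumFieldTheory.Balaban1983to89
open Literature.MathematicalPhysics.QuantumFieldTheory.Balaban1983to89.T3ContinuumYM3Torus
open Literature.MathematicalPhysics.QuantumFieldTheory.Balaban1983to89.T3UnitScaleTilt
open Literature.MathematicalPhysics.QuantumFieldTheory.Balaban1983to89.T3UnitLawDensityEML
open Summit.QuantumFields.YangMills.Theorems.PoincareLipschitzMesoscopicConcentrationOfEntropy (abs_le_of_lipschitz)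

namespace Summit.QuantumFields.YangMills.Theorems.CurvaturePoincareModerateDeviationOfRestrictedEntropy

/-- **MD ⟸ THE SMALL-TILT ENTROPY BOUND.**  Suppose that for every `L` there are `l₁ > 0`, `cE > 0`, `γ₁ ∈ (0,1]` such that for every
`T3Family F` with `F.L = L`, every `γ ∈ (0,γ₁]`, every `K`, every MESOSCOPIC box side `17·L³ < n ≤ β_K` (`1 ≤ n`, `2n ≤ sitesPerDir`), every
corner `x₀`, every measurable gauge-invariant `f` depending only on the bonds of `x₀ + [0,n)³` and `Λ`-Lipschitz (`Λ > 0`) in the `ℓ²` link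
metric, and every SMALL TILT `0 < l`, `(lΛ)² ≤ l₁²·β_K·n`:
`∫ e^{lf}(lf) dμ_K − (∫ e^{lf} dμ_K)·log ∫ e^{lf} dμ_K ≤ cE·(n²Λ²/β_K)·l²·∫ e^{lf} dμ_K`  (`μ_K = gibbsK`).
THEN the registered residual `stub_moderateDeviationResidual` of LINE 30 holds (text verbatim), with `Cc = 1` and
`cc = min (1/(4cE)) (l₁/(2(C_th+1)))`.  Proof: the class is bounded (✓`abs_le_of_lipschitz`), so the restricted-range Herbst argument
✓`herbst_windowed_tail_bound` applies with `c = cE n²Λ²/β_K`, `l₀ = l₁√(β_K n)/Λ`; in the window `β_K r² ≤ C_th Λ² n⁵` both of its branches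
are below `exp(−cc β_K r²/(n²Λ²))`. [cite: BakryGentilLedoux2014, Prop. 5.4.1] -/
theorem moderateDeviationResidual_of_restrictedEntropy
    (hEntR : ∀ (L : ℕ), ∃ l₁ : ℝ, 0 < l₁ ∧ ∃ cE : ℝ, 0 < cE ∧ ∃ γ₁ : ℝ, 0 < γ₁ ∧ γ₁ ≤ 1 ∧
      ∀ (F : T3Family) (γ : ℝ), F.L = L → 0 < γ → γ ≤ γ₁ → ∀ (K n : ℕ), 1 ≤ n →
        (n : ℝ) ≤ (F.scheme ℰp γ).β K → 2 * n ≤ (F.P K).sitesPerDir 0 → 17 * L ^ 3 < n →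
        ∀ (x₀ : Site (F.P K) 0) (f : GaugeField (F.P K) 0 (Matrix.specialUnitaryGroup (Fin 2) ℂ) → ℝ) (Λ : ℝ), 0 < Λ →
          Measurable f → GaugeField.GaugeInvariant f →
          (∀ U U' : GaugeField (F.P K) 0 (Matrix.specialUnitaryGroup (Fin 2) ℂ),
            (∀ b : PBond (F.P K) 0, (∀ k, (b.src k - x₀ k).val < n) → (∀ k, (b.tgt k - x₀ k).val < n) → U b = U' b) →
              f U = f U') →
          (∀ U U' : GaugeField (F.P K) 0 (Matrix.specialUnitaryGroup (Fin 2) ℂ),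
            |f U - f U'| ≤ Λ * Real.sqrt (∑ b : PBond (F.P K) 0, GaugeGroup.dist1 (U b * (U' b)⁻¹) ^ 2)) →
          ∀ l : ℝ, 0 < l → (l * Λ) ^ 2 ≤ l₁ ^ 2 * ((F.scheme ℰp γ).β K * (n : ℝ)) →
            ∫ U, Real.exp (l * f U) * (l * f U) ∂(gibbsK F ℰp γ K) -
                (∫ U, Real.exp (l * f U) ∂(gibbsK F ℰp γ K)) * Real.log (∫ U, Real.exp (l * f U) ∂(gibbsK F ℰp γ K)) ≤
              cE * ((n : ℝ) ^ 2 * Λ ^ 2 / (F.scheme ℰp γ).β K) * l ^ 2 * ∫ U, Real.exp (l * f U) ∂(gibbsK F ℰp γ K)) :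
    open Literature.MathematicalPhysics.QuantumFieldTheory.Balaban1983to89 Literature.MathematicalPhysics.QuantumFieldTheory.Balaban1983to89.T3ContinuumYM3Torus in ∀ (L : ℕ) (Cth : ℝ), 0 < Cth → ∃ (Cc cc : ℝ), 0 ≤ Cc ∧ 0 < cc ∧ ∃ γ₁ : ℝ, 0 < γ₁ ∧ γ₁ ≤ 1 ∧ ∀ (F : T3Family) (γ : ℝ), F.L = L → 0 < γ → γ ≤ γ₁ → ∀ (K n : ℕ), 1 ≤ n → (n : ℝ) ≤ (F.scheme T3UnitLawDensityEML.ℰp γ).β K → 2 * n ≤ (F.P K).sitesPerDir 0 → 17 * L ^ 3 < n → ∀ (x₀ : Site (F.P K) 0) (f : GaugeField (F.P K) 0 (Matrix.specialUnitaryGroup (Fin 2) ℂ) → ℝ) (Λ : ℝ), 0 < Λ → Measurable f → GaugeField.GaugeInvariant f → (∀ U U' : GaugeField (F.P K) 0 (Matrix.specialUnitaryGroup (Fin 2) ℂ), (∀ b : PBond (F.P K) 0, (∀ k, (b.src k - x₀ k).val < n) → (∀ k, (b.tgt k - x₀ k).val < n) → U b = U' b) → f U = f U') → (∀ U U' : GaugeField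 (F.P K) 0 (Matrix.specialUnitaryGroup (Fin 2) ℂ), |f U - f U'| ≤ Λ * Real.sqrt (∑ b : PBond (F.P K) 0, GaugeGroup.dist1 (U b * (U' b)⁻¹) ^ 2)) → ∀ r : ℝ, 0 ≤ r → (F.scheme T3UnitLawDensityEML.ℰp γ).β K * r ^ 2 ≤ Cth * Λ ^ 2 * (n : ℝ) ^ 5 → (T3UnitScaleTilt.gibbsK F T3UnitLawDensityEML.ℰp γ K).real {U | r ≤ f U - ∫ V, f V ∂(T3UnitScaleTilt.gibbsK F T3UnitLawDensityEML.ℰp γ K)} ≤ Cc * Real.exp (-(cc * (F.scheme T3UnitLawDensityEML.ℰp γ).β K * r ^ 2 / ((n : ℝ) ^ 2 * Λ ^ 2))) := by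
  intro L Cth hCth
  obtain ⟨l₁, hl₁, cE, hcE, γ₁, hγ₁, hγ₁1, H⟩ := hEntR L
  refine ⟨1, min (1 / (4 * cE)) (l₁ / (2 * (Cth + 1))), zero_le_one, lt_min (by positivity) (by positivity),
    γ₁, hγ₁, hγ₁1, ?_⟩
  intro F γ hFL hγ hγle K n hn hnβ h2n hnL x₀ f Λ hΛ hfm hinv hloc hLip r hr hwin
  haveI := isProbabilityMeasure_gibbsK F ℰp hγ.le K
  set μ := gibbsK F ℰp γ K with hμ
  set β : ℝ := (F.scheme ℰp γ).β K with hβ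
  set cc : ℝ := min (1 / (4 * cE)) (l₁ / (2 * (Cth + 1))) with hcc
  have hn1 : (1 : ℝ) ≤ (n : ℝ) := by exact_mod_cast hn
  have hn0 : (0 : ℝ) < (n : ℝ) := by linarith
  have hβ0 : 0 < β := by linarith [hn1.trans hnβ]
  -- Herbst data: constant at the Hodge–Poincaré scale, window of tilts
  set c : ℝ := cE * ((n : ℝ) ^ 2 * Λ ^ 2 / β) with hc
  have hc0 : 0 < c := by positivity
  set l₀ : ℝ := l₁ * Real.sqrt (β * (n : ℝ)) / Λ with hl₀def
  have hs0 : 0 < Real.sqrt (β * (n : ℝ)) := Real.sqrt_pos.2 (by positivity)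
  have hs2 : Real.sqrt (β * (n : ℝ)) ^ 2 = β * (n : ℝ) := Real.sq_sqrt (by positivity)
  have hl₀ : 0 < l₀ := by positivity
  have hbdd : ∃ C : ℝ, ∀ U, |f U| ≤ C :=
    ⟨|f 1| + Λ * Real.sqrt (∑ _b : PBond (F.P K) 0, (2 : ℝ) ^ 2), abs_le_of_lipschitz f hΛ.le hLip⟩
  have hEnt' : ∀ l : ℝ, 0 < l → l ≤ l₀ → ∫ U, Real.exp (l * f U) * (l * f U) ∂μ -
      (∫ U, Real.exp (l * f U) ∂μ) * Real.log (∫ U, Real.exp (l * f U) ∂μ) ≤ c * l ^ 2 * ∫ U, Real.exp (l * f U) ∂μ := by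
    intro l hl hll
    have h1 : l * Λ ≤ l₁ * Real.sqrt (β * (n : ℝ)) := by
      have h := mul_le_mul_of_nonneg_right hll hΛ.le
      have e : l₀ * Λ = l₁ * Real.sqrt (β * (n : ℝ)) := by
        rw [hl₀def]; field_simp
      linarith [h, e]
    have hsq : (l * Λ) ^ 2 ≤ l₁ ^ 2 * (β * (n : ℝ)) := by
      calc (l * Λ) ^ 2 ≤ (l₁ * Real.sqrt (β * (n : ℝ))) ^ 2 := pow_le_pow_left₀ (by positivity) h1 2
        _ = l₁ ^ 2 * (β * (n : ℝ)) := by rw [mul_pow, hs2]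
    rw [hμ, hc, hβ]
    exact H F γ hFL hγ hγle K n hn hnβ h2n hnL x₀ f Λ hΛ hfm hinv hloc hLip l hl hsq
  obtain ⟨hGauss, hExp⟩ :=
    Literature.Probability.Moments.herbst_windowed_tail_bound μ hfm hbdd hc0 hl₀ hEnt'
  have hQ0 : 0 ≤ β * r ^ 2 / ((n : ℝ) ^ 2 * Λ ^ 2) := by positivity
  rw [one_mul]
  rcases le_total r (2 * c * l₀) with hrw | hrw
  · -- inside the Herbst window: Gaussian rate `1/(4cE)`
    refine (hGauss r hr hrw).trans ?_
    rw [Real.exp_le_exp]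
    have h1 : cc * β * r ^ 2 / ((n : ℝ) ^ 2 * Λ ^ 2) ≤ 1 / (4 * cE) * β * r ^ 2 / ((n : ℝ) ^ 2 * Λ ^ 2) := by
      have e1 : cc * β * r ^ 2 / ((n : ℝ) ^ 2 * Λ ^ 2) = cc * (β * r ^ 2 / ((n : ℝ) ^ 2 * Λ ^ 2)) := by ring
      have e2 : 1 / (4 * cE) * β * r ^ 2 / ((n : ℝ) ^ 2 * Λ ^ 2) = 1 / (4 * cE) * (β * r ^ 2 / ((n : ℝ) ^ 2 * Λ ^ 2)) := by
        ring
      rw [e1, e2]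
      exact mul_le_mul_of_nonneg_right (min_le_left _ _) hQ0
    have e : 1 / (4 * cE) * β * r ^ 2 / ((n : ℝ) ^ 2 * Λ ^ 2) = r ^ 2 / (4 * c) := by
      rw [hc]; field_simp
    rw [neg_div]
    linarith [h1, e]
  · -- beyond the Herbst window but inside `β r² ≤ C_th Λ² n⁵`: the exponential branch dominates
    refine (hExp r hrw).trans ?_
    rw [Real.exp_le_exp, neg_le_neg_iff]
    have hr0 : 0 < r := lt_of_lt_of_le (by positivity) hrw
    set cc₂ : ℝ := l₁ / (2 * (Cth + 1)) with hcc₂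
    have hcc₂0 : 0 < cc₂ := by positivity
    -- `4 cc₂² C_th ≤ l₁²`
    have hkey : 4 * cc₂ ^ 2 * Cth ≤ l₁ ^ 2 := by
      have e : 4 * cc₂ ^ 2 * Cth = l₁ ^ 2 * (Cth / (Cth + 1) ^ 2) := by
        rw [hcc₂]; field_simp; ring
      have h1 : Cth / (Cth + 1) ^ 2 ≤ 1 := by
        rw [div_le_one (by positivity)]; nlinarith
      rw [e]
      exact (mul_le_mul_of_nonneg_left h1 (sq_nonneg l₁)).trans_eq (mul_one _)
    -- compare squares of `A = cc₂ β r/(n²Λ²)` and `B = l₀/2`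
    have hA0 : 0 ≤ cc₂ * β * r / ((n : ℝ) ^ 2 * Λ ^ 2) := by positivity
    have hB0 : 0 ≤ l₀ / 2 := by positivity
    have hAB : cc₂ * β * r / ((n : ℝ) ^ 2 * Λ ^ 2) ≤ l₀ / 2 := by
      rw [← pow_le_pow_iff_left₀ hA0 hB0 two_ne_zero]
      have eA : (cc₂ * β * r / ((n : ℝ) ^ 2 * Λ ^ 2)) ^ 2 = cc₂ ^ 2 * β ^ 2 * r ^ 2 / ((n : ℝ) ^ 4 * Λ ^ 4) := by
        rw [div_pow]; ring
      have eB : (l₀ / 2) ^ 2 = l₁ ^ 2 * (β * (n : ℝ)) / (4 * Λ ^ 2) := by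
        rw [hl₀def, div_pow, div_pow, mul_pow, hs2]; ring
      rw [eA, eB, div_le_div_iff₀ (by positivity) (by positivity)]
      -- `cc₂² β² r² · 4Λ² ≤ l₁² β n · n⁴ Λ⁴`, from `β r² ≤ C_th Λ² n⁵` and `4 cc₂² C_th ≤ l₁²`
      have h2 : cc₂ ^ 2 * β * Λ ^ 2 * (β * r ^ 2) ≤ cc₂ ^ 2 * β * Λ ^ 2 * (Cth * Λ ^ 2 * (n : ℝ) ^ 5) :=
        mul_le_mul_of_nonneg_left hwin (by positivity)
      have h3 : 4 * cc₂ ^ 2 * Cth * (β * Λ ^ 4 * (n : ℝ) ^ 5) ≤ l₁ ^ 2 * (β * Λ ^ 4 * (n : ℝ) ^ 5) :=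
        mul_le_mul_of_nonneg_right hkey (by positivity)
      nlinarith [h2, h3]
    have h1 : cc * β * r ^ 2 / ((n : ℝ) ^ 2 * Λ ^ 2) ≤ cc₂ * β * r ^ 2 / ((n : ℝ) ^ 2 * Λ ^ 2) := by
      have e1 : cc * β * r ^ 2 / ((n : ℝ) ^ 2 * Λ ^ 2) = cc * (β * r ^ 2 / ((n : ℝ) ^ 2 * Λ ^ 2)) := by ring
      have e2 : cc₂ * β * r ^ 2 / ((n : ℝ) ^ 2 * Λ ^ 2) = cc₂ * (β * r ^ 2 / ((n : ℝ) ^ 2 * Λ ^ 2)) := by ring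
      rw [e1, e2]
      exact mul_le_mul_of_nonneg_right (min_le_right _ _) hQ0
    have e3 : cc₂ * β * r ^ 2 / ((n : ℝ) ^ 2 * Λ ^ 2) = (cc₂ * β * r / ((n : ℝ) ^ 2 * Λ ^ 2)) * r := by ring
    have h4 : (cc₂ * β * r / ((n : ℝ) ^ 2 * Λ ^ 2)) * r ≤ (l₀ / 2) * r := mul_le_mul_of_nonneg_right hAB hr0.le
    have e4 : (l₀ / 2) * r = l₀ * r / 2 := by ring
    linarith [h1, e3, h4, e4]

/-- **THE K1 FACE v3: `PoincareLipschitz.MesoscopicConcentrationL` (stmt-QuantumFields-23532) BY NAME ⟸ THE SMALL-TILT ENTROPY BOUND ON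
MESOSCOPIC BOXES ALONE** — composition of `moderateDeviationResidual_of_restrictedEntropy` with the tree's K1 face v2
✓`PoincareLipschitzMesoscopicConcentrationLOfModerateDeviation.mesoscopicConcentrationL_of_moderateDeviation` (bounded boxes `n ≤ 17L³` and
the large-deviation regime on all boxes are tree theorems).  A DOOR: `hEntR` is NOT proved. [cite: BakryGentilLedoux2014, Prop. 5.4.1] -/
theorem mesoscopicConcentrationL_of_restrictedEntropy
    (hEntR : ∀ (L : ℕ), ∃ l₁ : ℝ, 0 < l₁ ∧ ∃ cE : ℝ, 0 < cE ∧ ∃ γ₁ : ℝ, 0 < γ₁ ∧ γ₁ ≤ 1 ∧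
      ∀ (F : T3Family) (γ : ℝ), F.L = L → 0 < γ → γ ≤ γ₁ → ∀ (K n : ℕ), 1 ≤ n →
        (n : ℝ) ≤ (F.scheme ℰp γ).β K → 2 * n ≤ (F.P K).sitesPerDir 0 → 17 * L ^ 3 < n →
        ∀ (x₀ : Site (F.P K) 0) (f : GaugeField (F.P K) 0 (Matrix.specialUnitaryGroup (Fin 2) ℂ) → ℝ) (Λ : ℝ), 0 < Λ →
          Measurable f → GaugeField.GaugeInvariant f →
          (∀ U U' : GaugeField (F.P K) 0 (Matrix.specialUnitaryGroup (Fin 2) ℂ),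
            (∀ b : PBond (F.P K) 0, (∀ k, (b.src k - x₀ k).val < n) → (∀ k, (b.tgt k - x₀ k).val < n) → U b = U' b) →
              f U = f U') →
          (∀ U U' : GaugeField (F.P K) 0 (Matrix.specialUnitaryGroup (Fin 2) ℂ),
            |f U - f U'| ≤ Λ * Real.sqrt (∑ b : PBond (F.P K) 0, GaugeGroup.dist1 (U b * (U' b)⁻¹) ^ 2)) →
          ∀ l : ℝ, 0 < l → (l * Λ) ^ 2 ≤ l₁ ^ 2 * ((F.scheme ℰp γ).β K * (n : ℝ)) →
            ∫ U, Real.exp (l * f U) * (l * f U) ∂(gibbsK F ℰp γ K) -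
                (∫ U, Real.exp (l * f U) ∂(gibbsK F ℰp γ K)) * Real.log (∫ U, Real.exp (l * f U) ∂(gibbsK F ℰp γ K)) ≤
              cE * ((n : ℝ) ^ 2 * Λ ^ 2 / (F.scheme ℰp γ).β K) * l ^ 2 * ∫ U, Real.exp (l * f U) ∂(gibbsK F ℰp γ K)) :
    Summit.QuantumFields.YangMills.Theses.PoincareLipschitz.MesoscopicConcentrationL :=
  Summit.QuantumFields.YangMills.Theorems.PoincareLipschitzMesoscopicConcentrationLOfModerateDeviation.mesoscopicConcentrationL_of_moderateDeviation
    (moderateDeviationResidual_of_restrictedEntropy hEntR)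

end Summit.QuantumFields.YangMills.Theorems.CurvaturePoincareModerateDeviationOfRestrictedEntropy

end
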